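import Summits.Ventures.PercRepro.GenQTopWitness
import Summits.Ventures.PercRepro.SixFourResidueThreeTail

/-!
# PercRepro — C-025 at `(6, 4)` on every finite matroid, route B: the third witness + Theorem 21′ (night-4, gen 0)

`rls_six_four_of_twentyOnePrime` (`GenQTopWitness.lean`: the row from the type-`3` balance alone) with p2's
`twentyOnePrime_holds` (`SixFourResidueThreeTail.lean`, Theorem 21′: `0 ≤ J₃(G)` on every solid with `≥ 10`
points) gives the row with no hypothesis: **`rls_six_four_holds_b : RLS M 6 4`** and its set-builder spelling
`c025_six_four_b`.  Route A is p3's `SixFourFinal.lean` through the `(6, 4)` residue of record; the two routes share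
`TypeThreeSmall` and `TwentyOnePrime` and nothing else above `SixFourT1`.
-/

namespace PercRepro.GenQ

open ThmH ThmN SixFour

/-- **C-025 at `(6, 4)` on every finite matroid** (route B): `RLS M 6 4`. -/
theorem rls_six_four_holds_b {α : Type} [DecidableEq α] (M : Matroid α) [M.Finite] : RLS M 6 4 :=
  rls_six_four_of_twentyOnePrime twentyOnePrime_holds M

/-- **C-025 at `(6, 4)` in the set-builder spelling of `C025`** (route B):
`Φ(6, 4) · #{A ⊆ E : ρ(A) = 6, ρ(E ∖ A) = 4} ≤ #{A ⊆ E : 4 < ρ(A) < 6}` on every finite matroid. -/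
theorem c025_six_four_b {α : Type} [DecidableEq α] (M : Matroid α) [M.Finite] :
    phiK 6 4 * ({A : Set α | A ⊆ M.E ∧ M.eRk A = ((6 : ℕ) : ℕ∞) ∧ M.eRk (M.E \ A) = ((4 : ℕ) : ℕ∞)}.ncard : ℚ) ≤
      ({A : Set α | A ⊆ M.E ∧ ((4 : ℕ) : ℕ∞) < M.eRk A ∧ M.eRk A < ((6 : ℕ) : ℕ∞)}.ncard : ℚ) :=
  c025_six_four_of_twentyOnePrime twentyOnePrime_holds M

end PercRepro.GenQ
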